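import Mathlib

/-!
# STUB-IDEAS k3 (gen 28) — UP–TWIST–DOWN: the `(3)₂` identification `KLF_cyc(𝔮)` as the DESCENT of
# de Shalit's two-variable Coleman identity at `p = 2`

Typed sketch for the crux idea card `stub-heegnerindexloweratwo-k3-g28` (crux
`PrintCf2.SplitBadTwoLowerHalfOfFacts`, item `stmt-BirchSwinnertonDyer-27851`, stub of record
`stub_heegnerIndexLowerAtTwo`).  TECHNIQUE family: decomposition (sub-stubs + PROVED glue).
Nothing is asserted: every atom is a HYPOTHESIS of a proved glue theorem; no `sorry`, no `axiom`,
no `instance`, no `notation`.  BSD is NOT proved by any of this.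

TARGET NODE (critic STUB-PLAN v5.1, HARDEST NOW = species {R174″ ∥ R175}; k3-g26 atom `KLF_cyc(𝔮)`):
the hypothesis `klf : ∀ i, Col (u i) = 𝓛 i` (+ `hCol`, `hnonexc`) of
`NekovarCutK3G26.threeTwo_keyUniform_of_cut`, with `M = H¹_Iw(ℚ₂^cyc/ℚ₂, T(key))`,
`T(key) = T_𝔭W|_{G_𝔮} = ℤ₂(β^{ur}χ_e)` (étale prime `𝔮` of `K₀ = ℚ(√-7)`, `2 = 𝔭𝔮`).

DECOMPOSITION (K1 ↦ Y + TW + DESC + ES-tw, glue proved below):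
* UP.   Over the local two-variable tower `L_∞ = K₀(𝔤_W 2^∞)_𝔔 ⊇ ℚ₂(μ_{2^∞})·ℚ₂^{ur,2}`,
        `G₂ = Gal(L_∞/ℚ₂)`, the character `η(key) = β^{ur}χ_e` of `T(key)` and `χ_cyc` factor through
        `G₂`, so `ρ(key) := η(key)·χ_cyc⁻¹` is a character of `G₂`, `T(key) = ℤ₂(1) ⊗ ρ(key)` and
        `M₂ := H¹_Iw(L_∞, T(key)) = tw_ρ(𝒰(L_∞))`, `𝒰` = principal semi-local units (Kummer).
        Globally `ρ(key) = ρ_W|_{G₂}` with `ρ_W = φ̄_W N⁻¹ = φ_W⁻¹` (`φ_W` = the `𝔮`-adic avatar of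
        `ψ_W`, de Shalit's embedding prime being OUR `𝔮`): KEY-UNIFORM although `φ_W` is not.
* Y.    (print, `W`-free) de Shalit's Coleman map `i_∞ : 𝒰(L_∞) ⊗̂ → Λ(G₂)` is an injective
        `G₂`-homomorphism with cokernel killed after `⊗ ℚ` [de Shalit 1987, I.3.4 Cor., I.3.7 Thm,
        I.3.8, II.4.6 Prop.; `p = 2` carried: I.3.1, II.4.12, II.4.17; LTYZ 2025 Thm 7.1 "Λ₂ =
        ⊕ i_∞(U_∞ e_λ)", detailed proof Li 2025 Glasgow], and `i_∞(e(𝔞)) = 12(σ_𝔞 - N𝔞)·μ(𝔤_W 𝔭^∞)`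
        [II.4.14 proof Step 1; LTYZ Thm 7.2].  Hypotheses `i₂`, `hY` below.
* TW.   `Col(key) := Tw_{ρ⁻¹} ∘ i_∞ ∘ tw_ρ⁻¹` is `Λ(G₂)`-LINEAR (`colT`, proved).  The measure is
        twisted by `ρ(key)⁻¹ = φ_W|_{G₂}` (weight `+1`): after descent the values are
        `∫ χ φ_W δ_𝔞 dμ`, `ε = χφ_W` of type `(1,0)`, IN RANGE of II.4.14 (36) — the cyclotomic
        2-adic L-function of `W`.  Typing `tw` as `τ`-semilinear catches a sign flip (B38).
* DESC. `π : Λ(G₂) ↠ Λ(Γ_cyc)`, `d = cores : M₂ → M` is (after `⊗ ℚ`) surjective with kernel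
        `ker(π)·M₂`, because `H²_Iw(L_∞, T(key)) = ℤ₂(ρ(key))` and `ρ(key)(h) ≠ 1` on the unramified
        generator (`β` has infinite order) [Nekovář Ast. 310, 8.4.8.1 (ii), (8.4.8.1.1)].
        `descend_existsUnique` (proved): `Col(key)` descends UNIQUELY to `Col : M →ₗ Λ(Γ)`.
* KLF.  `klf_cyc_of_twoVariable` (proved): `Col (d (tw (e i))) = π (τ (μ i))` for every member —
        k3-g26's `klf` with `𝓛 i := e_i · L_i`, `e_i = π Tw(12(σ_𝔞 - N𝔞))` a unit of `k⟦T⟧`;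
        `hnonexc` from surjectivity (`nonexc_of_descent`), `hCol` from linearity (`hCol_of_linear`),
        and the first-order coefficient is insensitive to the unit beyond `coeff 0 e`
        (`coeff_one_mul_of_coeff_zero_eq_zero`).
-/

set_option linter.dupNamespace false

namespace Summit.BirchSwinnertonDyer.BirchSwinnertonDyer.Cruxes.SplitBadTwoLowerHalfOfFacts.UpTwistDownK3G28

open PowerSeries Function

/-! ## TW — twist transport of a linear functional along a semilinear bijection (formal) -/

section Transport

variable {R : Type*} [CommRing R] {U M₂ : Type*} [AddCommGroup U] [Module R U]
  [AddCommGroup M₂] [Module R M₂]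

/-- Auxiliary: the inverse of a `τ`-semilinear additive bijection is `τ⁻¹`-semilinear. [folklore] -/
theorem symm_smul (τ : R ≃+* R) (tw : U ≃+ M₂) (htw : ∀ (r : R) (u : U), tw (r • u) = τ r • tw u)
    (r : R) (x : M₂) : tw.symm (r • x) = τ.symm r • tw.symm x := by
  apply tw.injective
  rw [htw, AddEquiv.apply_symm_apply, RingEquiv.apply_symm_apply, AddEquiv.apply_symm_apply]

/-- `Col(key) := τ ∘ Col₁ ∘ tw⁻¹`: transport of the (two-variable) Coleman functional `Col₁ = i_∞`
on units to the twisted module `M₂ = tw(𝒰) = H¹_Iw(L_∞, T(key))`; `τ = Tw_{ρ(key)⁻¹}` is the twisting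
ring automorphism of `Λ(G₂)`.  It is `Λ(G₂)`-LINEAR. [folklore; Rubin, Euler Systems, ch. VI] -/
def colT (τ : R ≃+* R) (tw : U ≃+ M₂) (htw : ∀ (r : R) (u : U), tw (r • u) = τ r • tw u)
    (Col₁ : U →ₗ[R] R) : M₂ →ₗ[R] R where
  toFun x := τ (Col₁ (tw.symm x))
  map_add' x y := by simp [map_add]
  map_smul' r x := by
    simp only [symm_smul τ tw htw, map_smul, smul_eq_mul, map_mul, RingEquiv.apply_symm_apply,
      RingHom.id_apply]

theorem colT_apply_tw (τ : R ≃+* R) (tw : U ≃+ M₂)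
    (htw : ∀ (r : R) (u : U), tw (r • u) = τ r • tw u) (Col₁ : U →ₗ[R] R) (u : U) :
    colT τ tw htw Col₁ (tw u) = τ (Col₁ u) := by
  simp [colT]

/-- Transport of the IDENTITY `i_∞(e) = μ` (atom Y) : `Col(key)(tw e) = Tw(μ)`. [folklore] -/
theorem colT_transport (τ : R ≃+* R) (tw : U ≃+ M₂)
    (htw : ∀ (r : R) (u : U), tw (r • u) = τ r • tw u) (Col₁ : U →ₗ[R] R) {e : U} {μ : R}
    (h : Col₁ e = μ) : colT τ tw htw Col₁ (tw e) = τ μ := by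
  rw [colT_apply_tw, h]

/-- Surjectivity survives transport (feeds `hnonexc`). [folklore] -/
theorem colT_surjective (τ : R ≃+* R) (tw : U ≃+ M₂)
    (htw : ∀ (r : R) (u : U), tw (r • u) = τ r • tw u) (Col₁ : U →ₗ[R] R)
    (hCol₁ : Surjective Col₁) : Surjective (colT τ tw htw Col₁) := by
  intro y
  obtain ⟨u, hu⟩ := hCol₁ (τ.symm y)
  exact ⟨tw u, by rw [colT_apply_tw, hu, RingEquiv.apply_symm_apply]⟩

end Transport

/-! ## DESC — descent of a `Λ₂`-linear functional along a surjective `π`-semilinear map -/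

section Descent

variable {Λ₂ Λ : Type*} [CommRing Λ₂] [CommRing Λ] {π : Λ₂ →+* Λ}
  {M₂ M : Type*} [AddCommGroup M₂] [Module Λ₂ M₂] [AddCommGroup M] [Module Λ M]

/-- `π ∘ Col₂` kills `ker(π)·M₂`. [folklore] -/
theorem comp_kills_kerSmul (Col₂ : M₂ →ₗ[Λ₂] Λ₂) {x : M₂}
    (hx : x ∈ (RingHom.ker π) • (⊤ : Submodule Λ₂ M₂)) : π (Col₂ x) = 0 := by
  refine Submodule.smul_induction_on hx ?_ ?_
  · intro r hr n _
    simp [map_smul, RingHom.mem_ker.mp hr]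
  · intro x y hx hy
    simp [map_add, hx, hy]

/-- DESC (V-level): if `d : M₂ → M` (corestriction `H¹_Iw(L_∞,T) → H¹_Iw(ℚ₂^cyc,T)`) is a
surjective `π`-semilinear map whose kernel lies in `ker(π)·M₂` (⟸ `H²_Iw(L_∞,T)^{h=1} = 0`,
Nekovář 8.4.8.1), and `π : Λ(G₂) → Λ(Γ)` is onto, then every `Λ(G₂)`-linear functional `Col₂`
descends UNIQUELY to a `Λ(Γ)`-linear `Col` with `Col ∘ d = π ∘ Col₂`. [folklore] -/
theorem descend_existsUnique (d : M₂ →ₛₗ[π] M) (hd : Surjective d) (hπ : Surjective π)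
    (hker : ∀ m : M₂, d m = 0 → m ∈ (RingHom.ker π) • (⊤ : Submodule Λ₂ M₂))
    (Col₂ : M₂ →ₗ[Λ₂] Λ₂) :
    ∃! Col : M →ₗ[Λ] Λ, ∀ m : M₂, Col (d m) = π (Col₂ m) := by
  have hwd : ∀ m m' : M₂, d m = d m' → π (Col₂ m) = π (Col₂ m') := by
    intro m m' h
    have h0 : π (Col₂ (m - m')) = 0 :=
      comp_kills_kerSmul Col₂ (hker _ (by rw [map_sub, h, sub_self]))
    rwa [map_sub, map_sub, sub_eq_zero] at h0
  choose s hs using hd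
  refine ⟨{ toFun := fun y => π (Col₂ (s y)), map_add' := ?_, map_smul' := ?_ }, ?_, ?_⟩
  · intro y y'
    rw [← map_add, ← map_add]
    exact hwd _ _ (by rw [map_add, hs, hs, hs])
  · intro c y
    obtain ⟨r, hr⟩ := hπ c
    have h1 : π (Col₂ (s (c • y))) = π (Col₂ (r • s y)) :=
      hwd _ _ (by rw [LinearMap.map_smulₛₗ, hs, hs, hr])
    rw [h1, map_smul, smul_eq_mul, map_mul, hr, RingHom.id_apply, smul_eq_mul]
  · intro m
    exact hwd _ _ (hs _)
  · intro Col' hCol'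
    apply LinearMap.ext
    intro y
    have := hCol' (s y)
    rw [hs] at this
    simpa using this

/-- Surjectivity descends (feeds `hnonexc` of k3-g26). [folklore] -/
theorem descend_surjective (d : M₂ →ₛₗ[π] M) (hπ : Surjective π) (Col₂ : M₂ →ₗ[Λ₂] Λ₂)
    (hCol₂ : Surjective Col₂) (Col : M →ₗ[Λ] Λ) (hCol : ∀ m : M₂, Col (d m) = π (Col₂ m)) :
    Surjective Col := by
  intro y
  obtain ⟨r, hr⟩ := hπ y
  obtain ⟨m, hm⟩ := hCol₂ r
  exact ⟨d m, by rw [hCol, hm, hr]⟩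

/-- The algebra behind DESC: `H²_Iw(L_∞, T(key)) ≅ ℤ₂(ρ)` has NO `h`-invariants as soon as
`ρ(h) ≠ 1` (domain coefficients). [folklore] -/
theorem twisted_invariants_vanish {A : Type*} [CommRing A] [IsDomain A] {ρh : A} (hρ : ρh ≠ 1)
    {x : A} (hx : ρh * x = x) : x = 0 := by
  have h : (ρh - 1) * x = 0 := by rw [sub_mul, one_mul, hx, sub_self]
  rcases mul_eq_zero.mp h with h1 | h1
  · exact absurd (sub_eq_zero.mp h1) hρ
  · exact h1

/-- Why `ρ(key)(h) ≠ 1` and is not even of finite order: `β = ψ_{49a1}(𝔮̄)` has complex absolute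
value `√2 ≠ 1`, so no power of it is `1` (hence neither is its image in `ℤ₂ˣ`). [folklore] -/
theorem pow_ne_one_of_norm_ne_one {F : Type*} [NormedDivisionRing F] {β : F} (hβ : ‖β‖ ≠ 1)
    {n : ℕ} (hn : n ≠ 0) : β ^ n ≠ 1 := by
  intro h
  have h2 : ‖β‖ ^ n = 1 := by rw [← norm_pow, h, norm_one]
  exact hβ ((pow_eq_one_iff_of_nonneg (norm_nonneg β) hn).mp h2)

end Descent

/-! ## KLF — the chain UP–TWIST–DOWN, output in the shape of k3-g26's hypotheses -/

section Chain

variable {Λ₂ Λ : Type*} [CommRing Λ₂] [CommRing Λ] {π : Λ₂ →+* Λ}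
  {U M₂ M : Type*} [AddCommGroup U] [Module Λ₂ U] [AddCommGroup M₂] [Module Λ₂ M₂]
  [AddCommGroup M] [Module Λ M]

/-- UP–TWIST–DOWN.  Hypotheses: `i₂` = de Shalit's two-variable Coleman map on units (atom Y),
`hY : i₂ (e i) = μ i` = the printed identity `i_∞(e(𝔞)) = 12(σ_𝔞-N𝔞)μ(𝔤_{W_i}𝔭^∞)` for each member,
`tw`/`τ` = twist by `ρ(key)` (TW), `d`/`π`/`hker` = descent data (DESC).  Conclusion: ONE
`Λ(Γ)`-linear `Col` on `M = H¹_Iw(ℚ₂^cyc, T(key))` (key-uniform) with k3-g26's `klf` for every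
member: `Col (u i) = 𝓛 i`, `u i := d (tw (e i))`, `𝓛 i := π (τ (μ i))`. [folklore] -/
theorem klf_cyc_of_twoVariable (τ : Λ₂ ≃+* Λ₂) (tw : U ≃+ M₂)
    (htw : ∀ (r : Λ₂) (u : U), tw (r • u) = τ r • tw u) (i₂ : U →ₗ[Λ₂] Λ₂)
    (d : M₂ →ₛₗ[π] M) (hd : Surjective d) (hπ : Surjective π)
    (hker : ∀ m : M₂, d m = 0 → m ∈ (RingHom.ker π) • (⊤ : Submodule Λ₂ M₂))
    {ι : Type*} (e : ι → U) (μ : ι → Λ₂) (hY : ∀ i, i₂ (e i) = μ i) :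
    ∃ Col : M →ₗ[Λ] Λ,
      (∀ m : M₂, Col (d m) = π (colT τ tw htw i₂ m)) ∧
      ∀ i, Col (d (tw (e i))) = π (τ (μ i)) := by
  obtain ⟨Col, hCol, -⟩ := descend_existsUnique d hd hπ hker (colT τ tw htw i₂)
  exact ⟨Col, hCol, fun i => by rw [hCol, colT_transport τ tw htw i₂ (hY i)]⟩

/-- `hnonexc` of k3-g26 is AUTOMATIC on this road: `i_∞ ⊗ ℚ` is onto (de Shalit I.3.7: finite
cokernel; LTYZ 2025 Thm 7.1), hence so is the descended `Col`, hence some `Col m` has non-zero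
constant term after any ring map `ev : Λ(Γ) → k⟦T⟧` into a non-trivial ring. [folklore] -/
theorem nonexc_of_descent {k : Type*} [CommRing k] [Nontrivial k] (τ : Λ₂ ≃+* Λ₂) (tw : U ≃+ M₂)
    (htw : ∀ (r : Λ₂) (u : U), tw (r • u) = τ r • tw u) (i₂ : U →ₗ[Λ₂] Λ₂)
    (hi₂ : Surjective i₂) (d : M₂ →ₛₗ[π] M) (hπ : Surjective π) (Col : M →ₗ[Λ] Λ)
    (hCol : ∀ m : M₂, Col (d m) = π (colT τ tw htw i₂ m)) (ev : Λ →+* PowerSeries k) :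
    ∃ m : M, coeff 0 (ev (Col m)) ≠ 0 := by
  obtain ⟨m, hm⟩ :=
    descend_surjective d hπ (colT τ tw htw i₂) (colT_surjective τ tw htw i₂ hi₂) Col hCol 1
  exact ⟨m, by simp [hm]⟩

/-- `hCol` of k3-g26 (`Col (σ m) = X * Col m`, `σ` = action of `γ - 1`) is LINEARITY read through
`ev : Λ(Γ) → k⟦T⟧`, `ev (γ-1) = X`. [folklore] -/
theorem hCol_of_linear {k : Type*} [CommRing k] (Col : M →ₗ[Λ] Λ) (ev : Λ →+* PowerSeries k)
    (γ₁ : Λ) (hγ : ev γ₁ = X) (m : M) : ev (Col (γ₁ • m)) = X * ev (Col m) := by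
  rw [map_smul, smul_eq_mul, map_mul, hγ]

end Chain

/-! ## The auxiliary unit `e_W = π Tw(12(σ_𝔞 - N𝔞))` is harmless at first order -/

section UnitStripping

variable {k : Type*} [CommRing k]

/-- With `L(0) = 0` (analytic rank one, `hL0`), the first-order coefficient of `e·L` only sees
`coeff 0 e` (member-uniform in valuation by the choice `𝔞 = (a_W)`, `ε_W(a_W) = 1`,
`a_W ≡ 5 (mod 8)` ⇒ `v₂(coeff 0 e_W) = 4`). [folklore] -/
theorem coeff_one_mul_of_coeff_zero_eq_zero (e L : PowerSeries k) (hL : coeff 0 L = 0) :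
    coeff 1 (e * L) = coeff 0 e * coeff 1 L := by
  simp only [PowerSeries.coeff_zero_eq_constantCoeff] at hL
  rw [PowerSeries.coeff_mul, Finset.Nat.antidiagonal_succ, Finset.sum_cons,
    Finset.Nat.antidiagonal_zero]
  simp [hL]

/-- … and `coeff 0 (e·L) = 0`, so k3-g26's `hL0` is inherited by `𝓛 := e·L`. [folklore] -/
theorem coeff_zero_mul_eq_zero (e L : PowerSeries k) (hL : coeff 0 L = 0) :
    coeff 0 (e * L) = 0 := by
  simp only [PowerSeries.coeff_zero_eq_constantCoeff] at hL
  simp [hL]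

/-- The auxiliary factor at the trivial character, `12·a·(ε - a)` with `ε = ε_W(a) = ±1`, is
non-zero for `a ∉ {0, 1, -1}` (so `e_W` is a unit of `k⟦T⟧` for a field `k` of characteristic 0);
it is NEVER a 2-adic unit (B13: we stay at V-level, as k3-g26's frame does). [folklore] -/
theorem aux_factor_ne_zero (a ε : ℤ) (hε : ε = 1 ∨ ε = -1) (ha0 : a ≠ 0) (ha1 : a ≠ 1)
    (ha2 : a ≠ -1) : 12 * a * (ε - a) ≠ 0 := by
  rcases hε with rfl | rfl
  · have : (1 : ℤ) - a ≠ 0 := sub_ne_zero.mpr (Ne.symm ha1)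
    positivity
  · have : (-1 : ℤ) - a ≠ 0 := sub_ne_zero.mpr (Ne.symm ha2)
    positivity

/-- The member-uniform valuation: for `a ≡ 5 (mod 8)` and `ε = 1`, `2^4 ∣ 12a(1-a)` and
`2^5 ∤ 12a(1-a)` — checked on residues mod 32. [folklore] -/
theorem aux_factor_valuation_mod32 :
    ∀ a : ZMod 32, (8 : ZMod 32) ∣ (a - 5) →
      (16 : ZMod 32) ∣ 12 * a * (1 - a) ∧ ¬ (12 * a * (1 - a) = 0) := by
  decide

end UnitStripping

/-! ## DICT — the dyadic dictionary making `χ_e` a character of the tower `L_∞ ⊇ ℚ₂(μ₈)·ℚ₂^{ur}` -/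

section Dict

/-- Every odd square class mod 8 is `±5^c`: `χ_{d'}|_{G_{ℚ₂}} = θ·υ^c` with `θ ∈ {1, χ_{-1}}·…`
cyclotomic (inside `ℚ₂(μ₈)`) and `υ = χ_5` unramified quadratic (inside `ℚ₂^{ur,2}`), so
`η(key) = β^{ur}χ_e` factors through `G₂ = Gal(L_∞/ℚ₂)`. [folklore] -/
theorem odd_classes_mod_eight :
    ∀ u : ZMod 8, u * u = 1 → (u = 1 ∨ u = -1 ∨ u = 5 ∨ u = -5) := by
  decide

/-- The six dyadic keys `(d mod 2, d' mod 8)` of the class `d ≢ 1 (mod 4)` and the local datum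
`(ε(key), c(key))` with `χ_d|_{G_{ℚ₂}} = χ_{ε}·χ_5^c`: `ε ∈ {-1, 2, -2}`; `n_v = 2` iff `ε = -1`
else `3` (conductor exponent of `χ_d` at 2).  Pure bookkeeping, by `decide`. [folklore] -/
def keyEps : Fin 6 → ℤ := ![-1, -1, 2, -2, -2, 2]
/-- see `keyEps`. [folklore] -/
def keyC : Fin 6 → ℕ := ![0, 1, 0, 0, 1, 1]
/-- see `keyEps`. [folklore] -/
def keyNv : Fin 6 → ℕ := ![2, 2, 3, 3, 3, 3]

theorem keyNv_eq : ∀ j : Fin 6, keyNv j = if keyEps j = -1 then 2 else 3 := by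
  decide

end Dict

/-! ## Anti-costume: the glue FIRES on an inhabited model (identity descent over `ℤ`) -/

section Fires

/-- The hypotheses of `descend_existsUnique` / `klf_cyc_of_twoVariable` are jointly satisfiable:
`Λ₂ = Λ = ℤ`, `π = id`, `d = id`, `τ = id`, `tw = id`, `i₂ = id`. [folklore] -/
example : ∃ Col : ℤ →ₗ[ℤ] ℤ,
    (∀ m : ℤ, Col ((LinearMap.id : ℤ →ₗ[ℤ] ℤ) m) =
      (RingHom.id ℤ) (colT (RingEquiv.refl ℤ) (AddEquiv.refl ℤ) (fun _ _ => rfl) LinearMap.id m)) ∧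
    ∀ i : Unit, Col ((LinearMap.id : ℤ →ₗ[ℤ] ℤ) ((AddEquiv.refl ℤ) ((fun _ => (3 : ℤ)) i))) =
      (RingHom.id ℤ) ((RingEquiv.refl ℤ) ((fun _ => (3 : ℤ)) i)) :=
  klf_cyc_of_twoVariable (π := RingHom.id ℤ) (RingEquiv.refl ℤ) (AddEquiv.refl ℤ) (fun _ _ => rfl)
    LinearMap.id LinearMap.id (fun m => ⟨m, rfl⟩) (fun r => ⟨r, rfl⟩)
    (fun m hm => by simp_all) (fun _ => (3 : ℤ)) (fun _ => (3 : ℤ)) (fun _ => rfl)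

end Fires

end Summit.BirchSwinnertonDyer.BirchSwinnertonDyer.Cruxes.SplitBadTwoLowerHalfOfFacts.UpTwistDownK3G28
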